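import Literature.MathematicalPhysics.QuantumFieldTheory.Balaban1983to89.B9WalkLettersKernelsStatic
import Literature.MathematicalPhysics.QuantumFieldTheory.Balaban1983to89.B9RWSumsCompleteGeo9YNbr

/-!
# `Balaban1983to89.B9WalkLettersKernelsRows` — W-a FILE C-2 (part 2b, proofs continued): THE ROW ∕ COLUMN SUMS OF THE KERNELS OF RECORD — the 27 clauses
# `StaticOK.K*_nonneg ∕ K*_loc ∕ K*_row ∕ K*_col` of the N06 certificate at `B9WalkLettersKernels`, with sizes `O(M_h⁻¹)` (print's «K(h_□) … of size O(M⁻¹)», (3.89))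

statement-level skeleton of published theorems with citation tags; proofs where landed; nothing here is a claim about the Yang–Mills mass gap

B9 = T. Bałaban, *Propagators for lattice gauge theories in a background field*, Commun. Math. Phys. **99** (1985) 389–434 [Balaban1985BackgroundPropagators];
[4] = T. Bałaban, *Propagators and renormalization transformations for lattice gauge theories. II*, Commun. Math. Phys. **96** (1984) 223–250 [Balaban1984PropagatorsII].
THE PRINT.  (3.89) p.409: «K(h_□) is a semi-local operator of size O(M⁻¹)»; [4] (2.44) p.230 (the row sums of the coefficient kernels against `Lʲ″η`, `(Lʲ″η)²`),
p.247 («|∂h_□| ≦ O(1)(MLʲη)⁻¹»), Lemma 2.1 (2.61) p.234 (finitely many blocks near a block), (2.2) p.224 (neighbouring blocks differ by at most one level).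
WHY THIS FILE (pub-ymgap, dag-n06-d W-a C-2 programme).  The N06 certificate displays `hst : ∀ x, StaticOK (𝔬 x) ρ N_c N′ C_ℓ (κ x)`, 27 of whose clauses concern the
nine coefficient kernels: `K*_nonneg`, `K*_loc` (range `≤ ρ`) and `K*_row ∕ K*_col` (row sums `Σ_{y″} K(a,y″)·ℓ(y″)^p ≤ 𝟙[a ∈ S′_□]·k` ∕ column sums).  At the kernels
of record of `B9WalkLettersKernels` (radius `ρ = 3`, `S′_□ := S_□ = SblkY`), above n06-l's radius-3 count threshold `nbrM₀Y … 3 ≤ M⋆`: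
* §1 located sums: `sum_locY_mul_le` (the indicator restricts a row sum to the radius-3 neighbourhood `nbr (geo9Y x) 3 a` and kills it off `S_□`), `sum_locY_le`,
  `sum_nbr_len_pow_le` (`Σ_{d(y″,a) ≤ 3} ℓ(y″)^p ≤ N₃·(L·ℓ(a))^p`: `len_le_of_dist_lt_M_geo9K` + `card_nbr_geo9Y_le_of_le`), the generic clauses `rowKY_row_le`,
  `colKY_col_le`;
* §2 ★★ THE CLAUSES (arithmetic `step_arith ∕ lap_arith` of part 2b-I against `sizes_mul_len_le`): `kernels_nonneg` (twelve), `kernels_row_loc ∕ kernels_col_loc ∕ kernels_dir_loc` (range 3), and the nine sums `kPY_row`, `kPLY_row`, `kCDY_row`,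
  `kPDY_row`, `kCLY_row`, ★ `kCY_row` (`kC = c_R⁻¹·CB·N₃·L²·((d+1)(5∕8)²C2F∕M_h² + sLipT∕(L·M_h))`), `kPtY_col`, `kCLtY_col`, `kCtY_col` — every size an explicit
  member-uniform constant times `M_h⁻¹` or `M_h⁻²` (print's `O(M⁻¹)`; the `Sizes` record and `Sizes.Bounded` are assembled with the record `opsWalkY` in part 3).
HONEST SCOPE.  Finite sums and arithmetic over landed engines; no (3.42), no regime, nothing of [B9]'s analysis asserted; count-neutral; N06 NOT discharged; nothing
continuum ∕ OS ∕ mass gap ∕ Clay.  Cell `pub-ymgap` (D-0062), node N06 [B9], rows 18, seat `pub-ymgap-dag-n06-d` (gen 14).  Net new unproved facts: 0.  NEW file.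
-/

noncomputable section

namespace Literature.MathematicalPhysics.QuantumFieldTheory.Balaban1983to89.B9WalkLettersKernelsRows

open Node00
open B6KLevelCensusIndexV1 (KIdx)
open B6Ineq2142KLevelV1 (β lvl)
open B6Cover236MultiLevelBlocks (cubes)
open B6Partition118KLevelFineSizes (C1F C1F_nonneg)
open B6Partition118KLevelFineSecond (C2F C2F_nonneg)
open B6Partition118KLevelTorusBinders (sLipT sLipT_nonneg)
open B9Thm37CubeCoverCommutatorSizes (side_conditions)
open B9Thm39ReadingCoords (cR39 cR39_nonneg)
open B9Ineq349SiteComposite (etaS_pos)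
open B9PinMembersKLevelV1 (MemberY geo9Y)
open B9GeoLemma21KLevelV1 (geo9Y_dist_comm geo9Y_len_pos)
open B9RWSumsReadsNbr (nbr mem_nbr)
open B9GeoNbrCountKLevelV1 (nbrM₀Y nbrCountY card_nbr_geo9Y_le_of_le)
open B9RWSumsCompleteGeo9YNbr (len_le_of_dist_lt_M_geo9K eight_le_M_geo9K)
open B9WalkLettersCoordsS (SblkY)
open B9WalkLettersKernels
open B9WalkLettersKernelsStatic (sizes_mul_len_le step_arith lap_arith)

variable {d ℓ : ℕ} {hd : 1 ≤ d + 1} {hL : Odd (ℓ + 1) ∧ 1 < ℓ + 1} {b₀ b₁ : ℝ} {Mstar : ℕ}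
variable {𝔸 : Type} [NormedRing 𝔸] [NormedAlgebra ℂ 𝔸] [FiniteDimensional ℝ 𝔸] {κ : Type} [Fintype κ]
variable (x : MemberY d ℓ hd hL b₀ b₁ Mstar) (b : Module.Basis κ ℝ 𝔸) (bI : FBondY x.toKIdx → IBondY x.toKIdx) [Fintype (geo9Y x).Site]

/-! ## §1 Located sums: the indicator restricts every row ∕ column sum to the radius-3 neighbourhood of a block of `S_□` -/

/-- ★ **the located row sum**: `Σ_{y″} locY(a, y″)·F(y″) ≤ 𝟙[a ∈ S_□]·Σ_{d(y″,a) ≤ 3} F(y″)` (any weight `F`; off `S_□` both sides vanish).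
[cite: Balaban1984PropagatorsII, (2.44) p.230, (2.51) p.232; Balaban1985BackgroundPropagators, (3.89) p.409] -/
theorem sum_locY_mul_le (c : ↥(cubes x.toKIdx.D.toDomains)) (a : (geo9Y x).Site) (F : (geo9Y x).Site → ℝ) :
    ∑ y'', locY x bI c a y'' * F y'' ≤ if a ∈ SblkY x bI c then ∑ y'' ∈ nbr (geo9Y x) 3 a, F y'' else 0 := by
  classical
  by_cases ha : a ∈ SblkY x bI c
  · rw [if_pos ha]
    have h1 : ∀ y'', locY x bI c a y'' * F y'' ≤ if y'' ∈ nbr (geo9Y x) 3 a then F y'' else 0 := fun y'' => by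
      by_cases h : (geo9Y x).dist a y'' ≤ 3
      · rw [locY_eq_one x bI c ha h, one_mul, if_pos (mem_nbr.2 (by rwa [geo9Y_dist_comm]))]
      · rw [locY_eq_zero_of_dist x bI c h, zero_mul, if_neg (fun hm => h (by rw [geo9Y_dist_comm]; exact mem_nbr.1 hm))]
    refine (Finset.sum_le_sum fun y'' _ => h1 y'').trans (le_of_eq ?_)
    rw [← Finset.sum_filter]
    exact Finset.sum_congr (by ext y; simp) fun _ _ => rfl
  · rw [if_neg ha]
    exact le_of_eq (Finset.sum_eq_zero fun y'' _ => by rw [locY_eq_zero_of_not_mem x bI c ha, zero_mul])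

/-- ★ **the located column count**: `Σ_{y″} locY(a, y″) ≤ 𝟙[a ∈ S_□]·#{y″ : d(y″,a) ≤ 3}`. [cite: Balaban1984PropagatorsII, (2.44) p.230, (2.51) p.232] -/
theorem sum_locY_le (c : ↥(cubes x.toKIdx.D.toDomains)) (a : (geo9Y x).Site) :
    ∑ y'', locY x bI c a y'' ≤ if a ∈ SblkY x bI c then ((nbr (geo9Y x) 3 a).card : ℝ) else 0 := by
  have h := sum_locY_mul_le x bI c a fun _ => (1 : ℝ)
  simp only [mul_one, Finset.sum_const, nsmul_eq_mul] at h
  exact h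

/-- ★ **the neighbourhood sum of the scale lengths**: `Σ_{d(y″,a) ≤ 3} ℓ(y″)^p ≤ N₃·(L·ℓ(a))^p` above the radius-3 count threshold (levels within distance
`3 < M` differ by at most one). [cite: Balaban1984PropagatorsII, (2.2) p.224, Lemma 2.1 (2.61) p.234; Balaban1985BackgroundPropagators, p.397 (Δ̃(y))] -/
theorem sum_nbr_len_pow_le (hM3 : nbrM₀Y d ℓ hd hL b₀ b₁ 3 ≤ Mstar) (a : (geo9Y x).Site) (p : ℕ) :
    ∑ y'' ∈ nbr (geo9Y x) 3 a, (geo9Y x).len y'' ^ p ≤ (nbrCountY d ℓ hd hL b₀ b₁ 3 : ℝ) * ((((ℓ + 1 : ℕ) : ℝ)) * (geo9Y x).len a) ^ p := by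
  have hterm : ∀ y'' ∈ nbr (geo9Y x) 3 a, (geo9Y x).len y'' ^ p ≤ ((((ℓ + 1 : ℕ) : ℝ)) * (geo9Y x).len a) ^ p := fun y'' hy => by
    have hd3 : (geo9Y x).dist y'' a ≤ 3 := mem_nbr.1 hy
    have hlt : (geo9Y x).dist y'' a < (geo9Y x).M := lt_of_le_of_lt hd3 (lt_of_lt_of_le (by norm_num) (eight_le_M_geo9K x.toKIdx))
    exact pow_le_pow_left₀ (geo9Y_len_pos x y'').le (len_le_of_dist_lt_M_geo9K x.toKIdx hlt) p
  calc ∑ y'' ∈ nbr (geo9Y x) 3 a, (geo9Y x).len y'' ^ p ≤ ∑ _y'' ∈ nbr (geo9Y x) 3 a, ((((ℓ + 1 : ℕ) : ℝ)) * (geo9Y x).len a) ^ p :=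
        Finset.sum_le_sum hterm
    _ = ((nbr (geo9Y x) 3 a).card : ℝ) * ((((ℓ + 1 : ℕ) : ℝ)) * (geo9Y x).len a) ^ p := by rw [Finset.sum_const, nsmul_eq_mul]
    _ ≤ (nbrCountY d ℓ hd hL b₀ b₁ 3 : ℝ) * ((((ℓ + 1 : ℕ) : ℝ)) * (geo9Y x).len a) ^ p :=
        mul_le_mul_of_nonneg_right (by exact_mod_cast card_nbr_geo9Y_le_of_le hM3 x a) (pow_nonneg (mul_nonneg (by positivity) (geo9Y_len_pos x a).le) p)

/-- ★ **the generic row clause**: a row-type kernel with a non-negative coefficient has `Σ_{y″} K(a,y″)·ℓ(y″)^p ≤ 𝟙[a ∈ S_□]·C(a)·N₃·(L·ℓ(a))^p`.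
[cite: Balaban1984PropagatorsII, (2.44) p.230; Balaban1985BackgroundPropagators, (3.89) p.409] -/
theorem rowKY_row_le (hM3 : nbrM₀Y d ℓ hd hL b₀ b₁ 3 ≤ Mstar) {C : (geo9Y x).Site → ℝ} (hC : ∀ a, 0 ≤ C a) (c : ↥(cubes x.toKIdx.D.toDomains))
    (a : (geo9Y x).Site) (p : ℕ) :
    ∑ y'', rowKY x bI C c a y'' * (geo9Y x).len y'' ^ p ≤
      if a ∈ SblkY x bI c then C a * ((nbrCountY d ℓ hd hL b₀ b₁ 3 : ℝ) * ((((ℓ + 1 : ℕ) : ℝ)) * (geo9Y x).len a) ^ p) else 0 := by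
  have h1 : ∑ y'', rowKY x bI C c a y'' * (geo9Y x).len y'' ^ p = C a * ∑ y'', locY x bI c a y'' * (geo9Y x).len y'' ^ p := by
    rw [Finset.mul_sum]; exact Finset.sum_congr rfl fun y'' _ => by rw [rowKY]; ring
  rw [h1]
  have h2 := sum_locY_mul_le x bI c a fun y'' => (geo9Y x).len y'' ^ p
  by_cases ha : a ∈ SblkY x bI c
  · rw [if_pos ha] at h2 ⊢
    exact mul_le_mul_of_nonneg_left (h2.trans (sum_nbr_len_pow_le x hM3 a p)) (hC a)
  · rw [if_neg ha] at h2 ⊢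
    have h3 : ∑ y'', locY x bI c a y'' * (geo9Y x).len y'' ^ p = 0 :=
      le_antisymm h2 (Finset.sum_nonneg fun y'' _ => mul_nonneg (locY_nonneg_le_one x bI c a y'').1 (pow_nonneg (geo9Y_len_pos x y'').le p))
    rw [h3, mul_zero]

/-- ★ **the generic column clause**: a column-type kernel has `Σ_{y″} K(y″, a) ≤ 𝟙[a ∈ S_□]·C(a)·N₃`. [cite: Balaban1984PropagatorsII, (2.44) p.230; Balaban1985BackgroundPropagators, (3.89) p.409] -/
theorem colKY_col_le (hM3 : nbrM₀Y d ℓ hd hL b₀ b₁ 3 ≤ Mstar) {C : (geo9Y x).Site → ℝ} (hC : ∀ a, 0 ≤ C a) (c : ↥(cubes x.toKIdx.D.toDomains))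
    (a : (geo9Y x).Site) :
    ∑ y'', colKY x bI C c y'' a ≤ if a ∈ SblkY x bI c then C a * (nbrCountY d ℓ hd hL b₀ b₁ 3 : ℝ) else 0 := by
  have h1 : ∑ y'', colKY x bI C c y'' a = C a * ∑ y'', locY x bI c a y'' := by
    rw [Finset.mul_sum]; exact Finset.sum_congr rfl fun y'' _ => by rw [colKY]
  rw [h1]
  have h2 := sum_locY_le x bI c a
  by_cases ha : a ∈ SblkY x bI c
  · rw [if_pos ha] at h2 ⊢
    exact mul_le_mul_of_nonneg_left (h2.trans (by exact_mod_cast card_nbr_geo9Y_le_of_le hM3 x a)) (hC a)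
  · rw [if_neg ha] at h2 ⊢
    have h3 : ∑ y'', locY x bI c a y'' = 0 := le_antisymm h2 (Finset.sum_nonneg fun y'' _ => (locY_nonneg_le_one x bI c a y'').1)
    rw [h3, mul_zero]

/-! ## §2 The `StaticOK` kernel clauses at the kernels of record (radius `ρ = 3`, `S′_□ = S_□`) -/

section Clauses

omit [Fintype (geo9Y x).Site] in
/-- `KPd KP KPtd KPt KPLd KPL KC KCt KCL KCD KCLt KPD ≥ 0` (`StaticOK.K*_nonneg`, `Identities₂.KPd_nonneg ∕ KPLd_nonneg ∕ KPtd_nonneg`).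
[cite: Balaban1984PropagatorsII, (2.39)–(2.44) pp.229–230, bookkeeping] -/
theorem kernels_nonneg (c : ↥(cubes x.toKIdx.D.toDomains)) (μ : Fin (d + 1)) (a y'' : (geo9Y x).Site) :
    0 ≤ kPdY x b bI c μ a y'' ∧ 0 ≤ kPY x b bI c a y'' ∧ 0 ≤ kPtdY x b bI c μ a y'' ∧ 0 ≤ kPtY x b bI c a y'' ∧ 0 ≤ kPLdY x b bI c μ a y'' ∧
      0 ≤ kPLY x b bI c a y'' ∧ 0 ≤ kCY x b bI c a y'' ∧ 0 ≤ kCtY x b bI c a y'' ∧ 0 ≤ kCLY x b bI c a y'' ∧ 0 ≤ kCDY x b bI c a y'' ∧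
      0 ≤ kCLtY x b bI c a y'' ∧ 0 ≤ kPDY x c a y'' := by
  have hd1 : (0 : ℝ) ≤ (d : ℝ) + 1 := by positivity
  exact ⟨rowKY_nonneg x bI (coefPY_nonneg x b c) c a y'', mul_nonneg hd1 (rowKY_nonneg x bI (coefPY_nonneg x b c) c a y''),
    colKY_nonneg x bI (coefPY_nonneg x b c) c a y'', mul_nonneg hd1 (colKY_nonneg x bI (coefPY_nonneg x b c) c a y''),
    rowKY_nonneg x bI (coefPLY_nonneg x b c) c a y'', mul_nonneg hd1 (rowKY_nonneg x bI (coefPLY_nonneg x b c) c a y''),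
    rowKY_nonneg x bI (coefCY_nonneg x b c) c a y'', colKY_nonneg x bI (coefCY_nonneg x b c) c a y'',
    rowKY_nonneg x bI (coefCLY_nonneg x b c) c a y'', rowKY_nonneg x bI (coefCDY_nonneg x b c) c a y'',
    colKY_nonneg x bI (coefCDY_nonneg x b c) c a y'', le_rfl⟩

omit [Fintype (geo9Y x).Site] in
/-- the row-type kernels have range `≤ 3` (`StaticOK.KP_loc ∕ KC_loc ∕ KPD_loc ∕ KCD_loc ∕ KPL_loc ∕ KCL_loc`).
[cite: Balaban1985BackgroundPropagators, (3.89) p.409 («semi-local»); Balaban1984PropagatorsII, (2.46) p.231] -/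
theorem kernels_row_loc (c : ↥(cubes x.toKIdx.D.toDomains)) (a y'' : (geo9Y x).Site) :
    (kPY x b bI c a y'' ≠ 0 → (geo9Y x).dist a y'' ≤ 3) ∧ (kCY x b bI c a y'' ≠ 0 → (geo9Y x).dist a y'' ≤ 3) ∧
    (kPDY x c a y'' ≠ 0 → (geo9Y x).dist a y'' ≤ 3) ∧ (kCDY x b bI c a y'' ≠ 0 → (geo9Y x).dist a y'' ≤ 3) ∧
    (kPLY x b bI c a y'' ≠ 0 → (geo9Y x).dist a y'' ≤ 3) ∧ (kCLY x b bI c a y'' ≠ 0 → (geo9Y x).dist a y'' ≤ 3) :=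
  ⟨fun h => rowKY_loc x bI _ c (right_ne_zero_of_mul h), fun h => rowKY_loc x bI _ c h, fun h => absurd rfl h,
    fun h => rowKY_loc x bI _ c h, fun h => rowKY_loc x bI _ c (right_ne_zero_of_mul h), fun h => rowKY_loc x bI _ c h⟩

omit [Fintype (geo9Y x).Site] in
/-- the column-type kernels have range `≤ 3` (`StaticOK.KPt_loc ∕ KCt_loc ∕ KCLt_loc`). [cite: Balaban1985BackgroundPropagators, (3.89) p.409; Balaban1984PropagatorsII, (2.46) p.231] -/
theorem kernels_col_loc (c : ↥(cubes x.toKIdx.D.toDomains)) (y'' a : (geo9Y x).Site) :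
    (kPtY x b bI c y'' a ≠ 0 → (geo9Y x).dist y'' a ≤ 3) ∧ (kCtY x b bI c y'' a ≠ 0 → (geo9Y x).dist y'' a ≤ 3) ∧
    (kCLtY x b bI c y'' a ≠ 0 → (geo9Y x).dist y'' a ≤ 3) :=
  ⟨fun h => colKY_loc x bI _ c (right_ne_zero_of_mul h), fun h => colKY_loc x bI _ c h, fun h => colKY_loc x bI _ c h⟩

omit [Fintype (geo9Y x).Site] in
/-- the per-direction kernels have range `≤ 3`. [cite: Balaban1985BackgroundPropagators, (3.89) p.409; Balaban1984PropagatorsII, (2.46) p.231] -/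
theorem kernels_dir_loc (c : ↥(cubes x.toKIdx.D.toDomains)) (μ : Fin (d + 1)) (a y'' : (geo9Y x).Site) :
    (kPdY x b bI c μ a y'' ≠ 0 → (geo9Y x).dist a y'' ≤ 3) ∧ (kPLdY x b bI c μ a y'' ≠ 0 → (geo9Y x).dist a y'' ≤ 3) ∧
    (kPtdY x b bI c μ y'' a ≠ 0 → (geo9Y x).dist y'' a ≤ 3) :=
  ⟨fun h => rowKY_loc x bI _ c h, fun h => rowKY_loc x bI _ c h, fun h => colKY_loc x bI _ c h⟩

variable (hlev : ∀ f : FBondY x.toKIdx, lvl x.hN x.D x.hk (bI f) = (B6GlobalChartV1.blkV1 x.hN x.D f).1.1)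
variable (hM3 : nbrM₀Y d ℓ hd hL b₀ b₁ 3 ≤ Mstar)
include hlev hM3

/-- ★★ **`StaticOK.KP_row`**: `Σ_{y″} KP(a,y″)·ℓ(y″) ≤ 𝟙[a ∈ S_□]·kP`, `kP = (d+1)·c_R⁻¹·CB·2·N₃·L·(5∕8)C1F∕M_h = O(M⁻¹)`.
[cite: Balaban1985BackgroundPropagators, (3.89) p.409 («O(M⁻¹)»); Balaban1984PropagatorsII, (2.44) p.230] -/
theorem kPY_row (c : ↥(cubes x.toKIdx.D.toDomains)) (a : (geo9Y x).Site) :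
    ∑ y'', kPY x b bI c a y'' * (geo9Y x).len y'' ≤
      if a ∈ SblkY x bI c then ((d : ℝ) + 1) * ((cR39 b)⁻¹ * cbY b * 2 * (nbrCountY d ℓ hd hL b₀ b₁ 3 : ℝ) * (((ℓ + 1 : ℕ) : ℝ)) *
        (5 / 8 * C1F d ℓ / x.toKIdx.Mh)) else 0 := by
  have hd1 : (0 : ℝ) ≤ (d : ℝ) + 1 := by positivity
  have h1 : ∑ y'', kPY x b bI c a y'' * (geo9Y x).len y'' = ((d : ℝ) + 1) * ∑ y'', rowKY x bI (coefPY x b c) c a y'' * (geo9Y x).len y'' ^ 1 := by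
    rw [Finset.mul_sum]; exact Finset.sum_congr rfl fun y'' _ => by rw [kPY, pow_one]; ring
  rw [h1]
  have h2 := rowKY_row_le x bI hM3 (coefPY_nonneg x b c) c a 1
  by_cases ha : a ∈ SblkY x bI c
  · rw [if_pos ha] at h2 ⊢
    refine mul_le_mul_of_nonneg_left (h2.trans ?_) hd1
    rw [pow_one, coefPY]
    have hs := (sizes_mul_len_le x bI hlev c ha).1
    have hP : 0 ≤ (cR39 b)⁻¹ * cbY b * 2 * (nbrCountY d ℓ hd hL b₀ b₁ 3 : ℝ) * (((ℓ + 1 : ℕ) : ℝ)) :=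
      mul_nonneg (mul_nonneg (mul_nonneg (mul_nonneg (inv_nonneg.2 (cR39_nonneg b)) (cbY_nonneg b)) zero_le_two) (Nat.cast_nonneg _)) (Nat.cast_nonneg _)
    calc (etaS x.toKIdx * cR39 b)⁻¹ * (cbY b * (2 * stepY x c)) * ((nbrCountY d ℓ hd hL b₀ b₁ 3 : ℝ) * ((((ℓ + 1 : ℕ) : ℝ)) * (geo9Y x).len a))
        = (etaS x.toKIdx)⁻¹ * ((cR39 b)⁻¹ * cbY b * 2 * (nbrCountY d ℓ hd hL b₀ b₁ 3 : ℝ) * (((ℓ + 1 : ℕ) : ℝ))) * stepY x c * (geo9Y x).len a := by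
          rw [mul_inv]; ring
      _ ≤ _ := step_arith x hP hs
  · rw [if_neg ha] at h2 ⊢
    have h3 : ∑ y'', rowKY x bI (coefPY x b c) c a y'' * (geo9Y x).len y'' ^ 1 = 0 :=
      le_antisymm h2 (Finset.sum_nonneg fun y'' _ => mul_nonneg (rowKY_nonneg x bI (coefPY_nonneg x b c) c a y'') (pow_nonneg (geo9Y_len_pos x y'').le 1))
    rw [h3, mul_zero]

/-- ★★ **`StaticOK.KPL_row`**: `Σ_{y″} KPL(a,y″)·ℓ(y″) ≤ 𝟙[a ∈ S_□]·kPL`, `kPL = (d+1)·CB·2·N₃·L·(5∕8)C1F∕M_h`. [cite: Balaban1985BackgroundPropagators, (3.88) p.409, (3.100) p.413; Balaban1984PropagatorsII, (2.44) p.230] -/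
theorem kPLY_row (c : ↥(cubes x.toKIdx.D.toDomains)) (a : (geo9Y x).Site) :
    ∑ y'', kPLY x b bI c a y'' * (geo9Y x).len y'' ≤
      if a ∈ SblkY x bI c then ((d : ℝ) + 1) * (cbY b * 2 * (nbrCountY d ℓ hd hL b₀ b₁ 3 : ℝ) * (((ℓ + 1 : ℕ) : ℝ)) * (5 / 8 * C1F d ℓ / x.toKIdx.Mh)) else 0 := by
  have hd1 : (0 : ℝ) ≤ (d : ℝ) + 1 := by positivity
  have h1 : ∑ y'', kPLY x b bI c a y'' * (geo9Y x).len y'' = ((d : ℝ) + 1) * ∑ y'', rowKY x bI (coefPLY x b c) c a y'' * (geo9Y x).len y'' ^ 1 := by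
    rw [Finset.mul_sum]; exact Finset.sum_congr rfl fun y'' _ => by rw [kPLY, pow_one]; ring
  rw [h1]
  have h2 := rowKY_row_le x bI hM3 (coefPLY_nonneg x b c) c a 1
  by_cases ha : a ∈ SblkY x bI c
  · rw [if_pos ha] at h2 ⊢
    refine mul_le_mul_of_nonneg_left (h2.trans ?_) hd1
    rw [pow_one, coefPLY]
    have hs := (sizes_mul_len_le x bI hlev c ha).1
    have hP : 0 ≤ cbY b * 2 * (nbrCountY d ℓ hd hL b₀ b₁ 3 : ℝ) * (((ℓ + 1 : ℕ) : ℝ)) :=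
      mul_nonneg (mul_nonneg (mul_nonneg (cbY_nonneg b) zero_le_two) (Nat.cast_nonneg _)) (Nat.cast_nonneg _)
    calc (etaS x.toKIdx)⁻¹ * (cbY b * (2 * stepY x c)) * ((nbrCountY d ℓ hd hL b₀ b₁ 3 : ℝ) * ((((ℓ + 1 : ℕ) : ℝ)) * (geo9Y x).len a))
        = (etaS x.toKIdx)⁻¹ * (cbY b * 2 * (nbrCountY d ℓ hd hL b₀ b₁ 3 : ℝ) * (((ℓ + 1 : ℕ) : ℝ))) * stepY x c * (geo9Y x).len a := by ring
      _ ≤ _ := step_arith x hP hs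
  · rw [if_neg ha] at h2 ⊢
    have h3 : ∑ y'', rowKY x bI (coefPLY x b c) c a y'' * (geo9Y x).len y'' ^ 1 = 0 :=
      le_antisymm h2 (Finset.sum_nonneg fun y'' _ => mul_nonneg (rowKY_nonneg x bI (coefPLY_nonneg x b c) c a y'') (pow_nonneg (geo9Y_len_pos x y'').le 1))
    rw [h3, mul_zero]

/-- ★★ **`StaticOK.KCD_row`**: `Σ_{y″} KCD(a,y″)·ℓ(y″)² ≤ 𝟙[a ∈ S_□]·kCD·ℓ(a)`, `kCD = CB·(d+1)·N₃·L²·(5∕8)C1F∕M_h`.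
[cite: Balaban1985BackgroundPropagators, (3.100) p.413; Balaban1984PropagatorsII, (2.39) p.229, (2.44) p.230] -/
theorem kCDY_row (c : ↥(cubes x.toKIdx.D.toDomains)) (a : (geo9Y x).Site) :
    ∑ y'', kCDY x b bI c a y'' * (geo9Y x).len y'' ^ 2 ≤
      if a ∈ SblkY x bI c then (cbY b * ((d : ℝ) + 1) * (nbrCountY d ℓ hd hL b₀ b₁ 3 : ℝ) * (((ℓ + 1 : ℕ) : ℝ)) ^ 2 * (5 / 8 * C1F d ℓ / x.toKIdx.Mh)) *
        (geo9Y x).len a else 0 := by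
  have h2 := rowKY_row_le x bI hM3 (coefCDY_nonneg x b c) c a 2
  by_cases ha : a ∈ SblkY x bI c
  · rw [if_pos ha] at h2 ⊢
    refine h2.trans ?_
    rw [coefCDY]
    have hs := (sizes_mul_len_le x bI hlev c ha).1
    have hlen := (geo9Y_len_pos x a).le
    have hP : 0 ≤ cbY b * ((d : ℝ) + 1) * (nbrCountY d ℓ hd hL b₀ b₁ 3 : ℝ) * (((ℓ + 1 : ℕ) : ℝ)) ^ 2 * (geo9Y x).len a :=
      mul_nonneg (mul_nonneg (mul_nonneg (mul_nonneg (cbY_nonneg b) (by positivity)) (Nat.cast_nonneg _)) (pow_nonneg (Nat.cast_nonneg _) 2)) hlen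
    calc (etaS x.toKIdx)⁻¹ * (cbY b * (((d : ℝ) + 1) * stepY x c)) * ((nbrCountY d ℓ hd hL b₀ b₁ 3 : ℝ) * ((((ℓ + 1 : ℕ) : ℝ)) * (geo9Y x).len a) ^ 2)
        = (etaS x.toKIdx)⁻¹ * (cbY b * ((d : ℝ) + 1) * (nbrCountY d ℓ hd hL b₀ b₁ 3 : ℝ) * (((ℓ + 1 : ℕ) : ℝ)) ^ 2 * (geo9Y x).len a) *
            stepY x c * (geo9Y x).len a := by ring
      _ ≤ (cbY b * ((d : ℝ) + 1) * (nbrCountY d ℓ hd hL b₀ b₁ 3 : ℝ) * (((ℓ + 1 : ℕ) : ℝ)) ^ 2 * (geo9Y x).len a) * (5 / 8 * C1F d ℓ / x.toKIdx.Mh) :=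
            step_arith x hP hs
      _ = _ := by ring
  · rw [if_neg ha] at h2 ⊢; exact h2

/-- **`StaticOK.KPD_row`** for the zero kernel (both sides vanish). [cite: Balaban1985BackgroundPropagators, (3.100) p.413, bookkeeping] -/
theorem kPDY_row (c : ↥(cubes x.toKIdx.D.toDomains)) (a : (geo9Y x).Site) :
    ∑ y'', kPDY x c a y'' * (geo9Y x).len y'' ≤ if a ∈ SblkY x bI c then 0 * (geo9Y x).len a else 0 := by
  have _h := hlev; have _h' := hM3
  rw [zero_mul, ite_self]
  exact le_of_eq (Finset.sum_eq_zero fun y'' _ => by rw [kPDY, zero_mul])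

/-- ★★ **`StaticOK.KCL_row`**: `Σ_{y″} KCL(a,y″)·ℓ(y″)² ≤ 𝟙[a ∈ S_□]·kCL`, `kCL = CB·(d+1)·N₃·L²·(5∕8)²C2F∕M_h²`. [cite: Balaban1985BackgroundPropagators, (3.88) p.409, (3.100) p.413; Balaban1984PropagatorsII, (2.44) p.230] -/
theorem kCLY_row (c : ↥(cubes x.toKIdx.D.toDomains)) (a : (geo9Y x).Site) :
    ∑ y'', kCLY x b bI c a y'' * (geo9Y x).len y'' ^ 2 ≤
      if a ∈ SblkY x bI c then cbY b * ((d : ℝ) + 1) * (nbrCountY d ℓ hd hL b₀ b₁ 3 : ℝ) * (((ℓ + 1 : ℕ) : ℝ)) ^ 2 *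
        ((5 / 8) ^ 2 * C2F d ℓ / (x.toKIdx.Mh : ℝ) ^ 2) else 0 := by
  have h2 := rowKY_row_le x bI hM3 (coefCLY_nonneg x b c) c a 2
  by_cases ha : a ∈ SblkY x bI c
  · rw [if_pos ha] at h2 ⊢
    refine h2.trans ?_
    rw [coefCLY]
    have hs := (sizes_mul_len_le x bI hlev c ha).2
    have hP : 0 ≤ cbY b * ((d : ℝ) + 1) * (nbrCountY d ℓ hd hL b₀ b₁ 3 : ℝ) * (((ℓ + 1 : ℕ) : ℝ)) ^ 2 :=
      mul_nonneg (mul_nonneg (mul_nonneg (cbY_nonneg b) (by positivity)) (Nat.cast_nonneg _)) (pow_nonneg (Nat.cast_nonneg _) 2)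
    calc (etaS x.toKIdx ^ 2)⁻¹ * (cbY b * (((d : ℝ) + 1) * lapStepY x c)) * ((nbrCountY d ℓ hd hL b₀ b₁ 3 : ℝ) * ((((ℓ + 1 : ℕ) : ℝ)) * (geo9Y x).len a) ^ 2)
        = (etaS x.toKIdx ^ 2)⁻¹ * (cbY b * ((d : ℝ) + 1) * (nbrCountY d ℓ hd hL b₀ b₁ 3 : ℝ) * (((ℓ + 1 : ℕ) : ℝ)) ^ 2) * lapStepY x c *
            (geo9Y x).len a ^ 2 := by ring
      _ ≤ _ := lap_arith x hP hs
  · rw [if_neg ha] at h2 ⊢; exact h2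

/-- ★★ **`StaticOK.KC_row`**: `Σ_{y″} KC(a,y″)·ℓ(y″)² ≤ 𝟙[a ∈ S_□]·kC`, `kC = c_R⁻¹·CB·N₃·L²·((d+1)·(5∕8)²C2F∕M_h² + sLipT∕(L·M_h)) = O(M⁻¹)` (Laplacian line +
averaging line; the weight `(η∕ℓ(a))²` cancels the `ℓ(a)²` of the clause). [cite: Balaban1985BackgroundPropagators, (3.89) p.409 («O(M⁻¹)»); Balaban1984PropagatorsII, (2.14) p.225, (2.44) p.230] -/
theorem kCY_row (c : ↥(cubes x.toKIdx.D.toDomains)) (a : (geo9Y x).Site) :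
    ∑ y'', kCY x b bI c a y'' * (geo9Y x).len y'' ^ 2 ≤
      if a ∈ SblkY x bI c then (cR39 b)⁻¹ * cbY b * (nbrCountY d ℓ hd hL b₀ b₁ 3 : ℝ) * (((ℓ + 1 : ℕ) : ℝ)) ^ 2 *
        (((d : ℝ) + 1) * ((5 / 8) ^ 2 * C2F d ℓ / (x.toKIdx.Mh : ℝ) ^ 2) + avgLipY x) else 0 := by
  have h2 := rowKY_row_le x bI hM3 (coefCY_nonneg x b c) c a 2
  by_cases ha : a ∈ SblkY x bI c
  · rw [if_pos ha] at h2 ⊢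
    refine h2.trans ?_
    rw [coefCY]
    have hs := (sizes_mul_len_le x bI hlev c ha).2
    have hη := etaS_pos x.toKIdx
    have hlen := geo9Y_len_pos x a
    set P : ℝ := (cR39 b)⁻¹ * cbY b * (nbrCountY d ℓ hd hL b₀ b₁ 3 : ℝ) * (((ℓ + 1 : ℕ) : ℝ)) ^ 2 with hPdef
    have hP : 0 ≤ P := mul_nonneg (mul_nonneg (mul_nonneg (inv_nonneg.2 (cR39_nonneg b)) (cbY_nonneg b)) (Nat.cast_nonneg _)) (pow_nonneg (Nat.cast_nonneg _) 2)
    have hd1 : (0 : ℝ) ≤ (d : ℝ) + 1 := by positivity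
    -- split the coefficient: the Laplacian line and the averaging line
    have e : (etaS x.toKIdx ^ 2 * cR39 b)⁻¹ * (cbY b * (((d : ℝ) + 1) * lapStepY x c + (etaS x.toKIdx / (geo9Y x).len a) ^ 2 * avgLipY x)) *
        ((nbrCountY d ℓ hd hL b₀ b₁ 3 : ℝ) * ((((ℓ + 1 : ℕ) : ℝ)) * (geo9Y x).len a) ^ 2)
        = (etaS x.toKIdx ^ 2)⁻¹ * (P * ((d : ℝ) + 1)) * lapStepY x c * (geo9Y x).len a ^ 2 + P * avgLipY x := by
      rw [hPdef, mul_inv]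
      field_simp
    rw [e]
    calc (etaS x.toKIdx ^ 2)⁻¹ * (P * ((d : ℝ) + 1)) * lapStepY x c * (geo9Y x).len a ^ 2 + P * avgLipY x
        ≤ P * ((d : ℝ) + 1) * ((5 / 8) ^ 2 * C2F d ℓ / (x.toKIdx.Mh : ℝ) ^ 2) + P * avgLipY x := by
          have := lap_arith x (mul_nonneg hP hd1) hs
          linarith
      _ = P * (((d : ℝ) + 1) * ((5 / 8) ^ 2 * C2F d ℓ / (x.toKIdx.Mh : ℝ) ^ 2) + avgLipY x) := by ring
  · rw [if_neg ha] at h2 ⊢; exact h2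

/-- ★★ **`StaticOK.KPt_col`**: `(Σ_{y″} KPt(y″,b))·ℓ(b) ≤ 𝟙[b ∈ S_□]·kPt`, `kPt = (d+1)·c_R⁻¹·CB·2·N₃·(5∕8)C1F∕M_h`.
[cite: Balaban1985BackgroundPropagators, (3.88)–(3.89) p.409 (transposed form); Balaban1984PropagatorsII, (2.44) p.230] -/
theorem kPtY_col (c : ↥(cubes x.toKIdx.D.toDomains)) (a : (geo9Y x).Site) :
    (∑ y'', kPtY x b bI c y'' a) * (geo9Y x).len a ≤
      if a ∈ SblkY x bI c then ((d : ℝ) + 1) * ((cR39 b)⁻¹ * cbY b * 2 * (nbrCountY d ℓ hd hL b₀ b₁ 3 : ℝ) * (5 / 8 * C1F d ℓ / x.toKIdx.Mh)) else 0 := by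
  have hd1 : (0 : ℝ) ≤ (d : ℝ) + 1 := by positivity
  have hlen := (geo9Y_len_pos x a).le
  have h1 : ∑ y'', kPtY x b bI c y'' a = ((d : ℝ) + 1) * ∑ y'', colKY x bI (coefPY x b c) c y'' a := by
    rw [Finset.mul_sum]; exact Finset.sum_congr rfl fun y'' _ => by rw [kPtY]
  rw [h1]
  have h2 := colKY_col_le x bI hM3 (coefPY_nonneg x b c) c a
  by_cases ha : a ∈ SblkY x bI c
  · rw [if_pos ha] at h2 ⊢
    rw [mul_assoc]
    refine mul_le_mul_of_nonneg_left ((mul_le_mul_of_nonneg_right h2 hlen).trans ?_) hd1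
    rw [coefPY]
    have hs := (sizes_mul_len_le x bI hlev c ha).1
    have hP : 0 ≤ (cR39 b)⁻¹ * cbY b * 2 * (nbrCountY d ℓ hd hL b₀ b₁ 3 : ℝ) :=
      mul_nonneg (mul_nonneg (mul_nonneg (inv_nonneg.2 (cR39_nonneg b)) (cbY_nonneg b)) zero_le_two) (Nat.cast_nonneg _)
    calc (etaS x.toKIdx * cR39 b)⁻¹ * (cbY b * (2 * stepY x c)) * (nbrCountY d ℓ hd hL b₀ b₁ 3 : ℝ) * (geo9Y x).len a
        = (etaS x.toKIdx)⁻¹ * ((cR39 b)⁻¹ * cbY b * 2 * (nbrCountY d ℓ hd hL b₀ b₁ 3 : ℝ)) * stepY x c * (geo9Y x).len a := by rw [mul_inv]; ring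
      _ ≤ _ := step_arith x hP hs
  · rw [if_neg ha] at h2 ⊢
    have h3 : ∑ y'', colKY x bI (coefPY x b c) c y'' a = 0 :=
      le_antisymm h2 (Finset.sum_nonneg fun y'' _ => colKY_nonneg x bI (coefPY_nonneg x b c) c y'' a)
    rw [h3, mul_zero, zero_mul]

/-- ★★ **`StaticOK.KCLt_col`**: `(Σ_{y″} KCLt(y″,b))·ℓ(b) ≤ 𝟙[b ∈ S_□]·kCLt`, `kCLt = CB·(d+1)·N₃·(5∕8)C1F∕M_h`. [cite: Balaban1985BackgroundPropagators, (3.100) p.413, (3.8) p.392; Balaban1984PropagatorsII, (2.44) p.230] -/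
theorem kCLtY_col (c : ↥(cubes x.toKIdx.D.toDomains)) (a : (geo9Y x).Site) :
    (∑ y'', kCLtY x b bI c y'' a) * (geo9Y x).len a ≤
      if a ∈ SblkY x bI c then cbY b * ((d : ℝ) + 1) * (nbrCountY d ℓ hd hL b₀ b₁ 3 : ℝ) * (5 / 8 * C1F d ℓ / x.toKIdx.Mh) else 0 := by
  have hlen := (geo9Y_len_pos x a).le
  have h2 := colKY_col_le x bI hM3 (coefCDY_nonneg x b c) c a
  by_cases ha : a ∈ SblkY x bI c
  · rw [if_pos ha] at h2 ⊢
    refine (mul_le_mul_of_nonneg_right h2 hlen).trans ?_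
    rw [coefCDY]
    have hs := (sizes_mul_len_le x bI hlev c ha).1
    have hP : 0 ≤ cbY b * ((d : ℝ) + 1) * (nbrCountY d ℓ hd hL b₀ b₁ 3 : ℝ) :=
      mul_nonneg (mul_nonneg (cbY_nonneg b) (by positivity)) (Nat.cast_nonneg _)
    calc (etaS x.toKIdx)⁻¹ * (cbY b * (((d : ℝ) + 1) * stepY x c)) * (nbrCountY d ℓ hd hL b₀ b₁ 3 : ℝ) * (geo9Y x).len a
        = (etaS x.toKIdx)⁻¹ * (cbY b * ((d : ℝ) + 1) * (nbrCountY d ℓ hd hL b₀ b₁ 3 : ℝ)) * stepY x c * (geo9Y x).len a := by ring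
      _ ≤ _ := step_arith x hP hs
  · rw [if_neg ha] at h2 ⊢
    exact (mul_le_mul_of_nonneg_right h2 hlen).trans_eq (zero_mul _)

/-- ★★ **`StaticOK.KCt_col`**: `(Σ_{y″} KCt(y″,b))·ℓ(b)² ≤ 𝟙[b ∈ S_□]·kCt`, `kCt = c_R⁻¹·CB·N₃·((d+1)·(5∕8)²C2F∕M_h² + sLipT∕(L·M_h))`.
[cite: Balaban1985BackgroundPropagators, (3.88)–(3.89) p.409 (transposed form); Balaban1984PropagatorsII, (2.14) p.225, (2.44) p.230] -/
theorem kCtY_col (c : ↥(cubes x.toKIdx.D.toDomains)) (a : (geo9Y x).Site) :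
    (∑ y'', kCtY x b bI c y'' a) * (geo9Y x).len a ^ 2 ≤
      if a ∈ SblkY x bI c then (cR39 b)⁻¹ * cbY b * (nbrCountY d ℓ hd hL b₀ b₁ 3 : ℝ) *
        (((d : ℝ) + 1) * ((5 / 8) ^ 2 * C2F d ℓ / (x.toKIdx.Mh : ℝ) ^ 2) + avgLipY x) else 0 := by
  have hlen := geo9Y_len_pos x a
  have h2 := colKY_col_le x bI hM3 (coefCY_nonneg x b c) c a
  by_cases ha : a ∈ SblkY x bI c
  · rw [if_pos ha] at h2 ⊢
    refine (mul_le_mul_of_nonneg_right h2 (pow_nonneg hlen.le 2)).trans ?_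
    rw [coefCY]
    have hs := (sizes_mul_len_le x bI hlev c ha).2
    have hη := etaS_pos x.toKIdx
    set P : ℝ := (cR39 b)⁻¹ * cbY b * (nbrCountY d ℓ hd hL b₀ b₁ 3 : ℝ) with hPdef
    have hP : 0 ≤ P := mul_nonneg (mul_nonneg (inv_nonneg.2 (cR39_nonneg b)) (cbY_nonneg b)) (Nat.cast_nonneg _)
    have hd1 : (0 : ℝ) ≤ (d : ℝ) + 1 := by positivity
    have e : (etaS x.toKIdx ^ 2 * cR39 b)⁻¹ * (cbY b * (((d : ℝ) + 1) * lapStepY x c + (etaS x.toKIdx / (geo9Y x).len a) ^ 2 * avgLipY x)) *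
        (nbrCountY d ℓ hd hL b₀ b₁ 3 : ℝ) * (geo9Y x).len a ^ 2
        = (etaS x.toKIdx ^ 2)⁻¹ * (P * ((d : ℝ) + 1)) * lapStepY x c * (geo9Y x).len a ^ 2 + P * avgLipY x := by
      rw [hPdef, mul_inv]
      field_simp
    rw [e]
    calc (etaS x.toKIdx ^ 2)⁻¹ * (P * ((d : ℝ) + 1)) * lapStepY x c * (geo9Y x).len a ^ 2 + P * avgLipY x
        ≤ P * ((d : ℝ) + 1) * ((5 / 8) ^ 2 * C2F d ℓ / (x.toKIdx.Mh : ℝ) ^ 2) + P * avgLipY x := by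
          have := lap_arith x (mul_nonneg hP hd1) hs
          linarith
      _ = P * (((d : ℝ) + 1) * ((5 / 8) ^ 2 * C2F d ℓ / (x.toKIdx.Mh : ℝ) ^ 2) + avgLipY x) := by ring
  · rw [if_neg ha] at h2 ⊢
    exact (mul_le_mul_of_nonneg_right h2 (pow_nonneg hlen.le 2)).trans_eq (zero_mul _)

end Clauses

end Literature.MathematicalPhysics.QuantumFieldTheory.Balaban1983to89.B9WalkLettersKernelsRows

end
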